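import Summits.PneNP.PneNP.Theorems.SymmetryBudgetWindowCanoniserLevelsChild

/-!
# Window canoniser, VII: every wire of a main gate points down; acyclicity of the wiring

Route `PneNP/SymmetryBudget`, dichotomy `WindowBarrier` (stmt-PneNP-2145) / `NoHiddenOrder` (stmt-PneNP-14781);
continuation of `…WindowCanoniserLevelsChild.lean`.  `WCan.OK a.al (a.args i)` for the main atoms
(`Kind.argsM_ok`), then for all atoms (`Atom.args_ok`) and all gates (**`Node.level_lt_of_args`**: every wire
leads to a gate of strictly smaller level).
-/

-- `Summit.PneNP.PneNP.…` duplicates `PneNP` BY DESIGN (single-problem summit, D-0017 layout).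
set_option linter.dupNamespace false

noncomputable section

namespace Summit.PneNP.PneNP.Theorems

namespace WCan

open Finset Equiv Literature.Computability.Complexity

variable {K r n : ℕ} [NeZero n]

/-! ### Main atoms -/

section Main

variable (L : Lab K n)

set_option maxHeartbeats 2000000 in
/-- **Every wire of a main atom points down.** -/
theorem Kind.argsM_ok (k : Kind) (hk : k.isReplay = false) (P : Prm r n) (i : Fin (k.fn r n).1) :
    OK (Atom.lab L k P : Atom K r n).al (k.argsM L P i) := by
  rw [al_lab_replay]
  have hRS : RS n = 4 * n + 8 := rfl
  have hT : (T n + 1) * RS n = T n * RS n + RS n := Nat.succ_mul _ _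
  have hpos : ∀ X, 0 < lb L + X := lb_pos L
  cases k <;> simp [Kind.isReplay] at hk <;> simp only [Kind.argsM, Kind.loc]
  case rkGE =>
    refine ok_cnt (fun w' => ok_w1_n1and ?_ (hpos _)) (hpos _) i
    simp only [List.mem_cons, List.not_mem_nil, or_false, forall_eq_or_imp, forall_eq, al_aW, al_aLT, Fin.val_last]
    omega
  case mtch =>
    rcases hc : chLab L P with _ | Lc
    · exact ok_append (ok_append (fun v => ok_wA (al_ffA_lt L _)) (fun v => ok_wA (al_ffA_lt L _)))
        (fun j => ok_wA (al_ffA_lt L _)) i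
    · have hM := M_chLab_lt L hc
      refine ok_append (ok_append (fun v => ?_) (fun v => ?_)) (fun j => ?_) i <;>
        refine ok_w2_iffF ?_ ?_ (hpos _) <;>
        first | exact child_replay_lt0 hM _ _ | (simp only [al_aW, al_aC, al_aLT, Fin.val_last]; omega)
  case thru =>
    rcases hc : chLab L P with _ | Lc
    · exact ok_wA (al_ffA_lt L _)
    · have hM := M_chLab_lt L hc
      refine ok_w1_n1and ?_ (hpos _)
      intro l hl
      rw [List.mem_append] at hl
      rcases hl with hl | hl
      · simp only [List.mem_cons, List.not_mem_nil, or_false] at hl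
        rcases hl with rfl | rfl
        · show lb L + Kind.loc n _ Kind.mtch < _
          simp only [Kind.loc]; omega
        · exact child_replay_lt hM _ (by simp [RS]) _
      · split_ifs at hl
        · simp at hl
        · simp only [List.mem_singleton] at hl
          subst hl
          exact child_replay_lt hM _ (by simp [RS]) _
  case cert =>
    rcases hc : chLab L P with _ | Lc
    · exact ok_wA (al_ffA_lt L _)
    · have hM := M_chLab_lt L hc
      dsimp only
      split_ifs
      · exact ok_wA (by show lb L + Kind.loc n _ Kind.thru < _; simp only [Kind.loc]; omega)
      · exact ok_wA (child_replay_lt0 hM _ _)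
      · exact ok_wN (child_replay_lt0 hM _ _)
      · exact ok_nonbotF Lc _ (child_main_lt hM 4 (by norm_num) _)
  case pcand =>
    rcases hc : candLab L (P.vs 0) P.h1 with _ | Lc
    · exact ok_wA (al_ffA_lt L _)
    · have hM := M_candLab_lt L hc
      refine ok_w2_n2and ?_ (hpos _)
      simp only [List.mem_cons, List.not_mem_nil, or_false, forall_eq_or_imp, forall_eq]
      exact ⟨n1ok_litN1 (child_main_lt hM 11 (by norm_num) _) (hpos _), n1ok_rkF Lc _ _ (child_main_lt0 hM _),
        n1ok_litN1 (child_replay_lt0 hM _ _) (hpos _)⟩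
  case lcrk =>
    refine ok_w2_n2and ?_ (hpos _)
    simp only [List.mem_cons, List.not_mem_nil, or_false, forall_eq_or_imp, forall_eq]
    exact ⟨n1ok_litN1 (by simp only [al_aPcand]; omega) (hpos _), n1ok_rkF L _ _ (by omega)⟩
  case pfx =>
    split_ifs
    · exact ok_w2_iffF (al_lbitA_lt L _ _ 2 le_rfl) (al_lbitA_lt L _ _ 2 le_rfl) (hpos _)
    · exact ok_wA (al_ttA_lt L _)
  case lexLE =>
    split_ifs
    · refine ok_w1_n1and ?_ (hpos _)
      simp only [List.mem_cons, List.not_mem_nil, or_false, forall_eq_or_imp, forall_eq, al_aPfx]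
      exact ⟨by omega, al_lbitA_lt L _ _ 3 (by norm_num), al_lbitA_lt L _ _ 3 (by norm_num)⟩
    · exact ok_wA (by simp only [al_aPfx]; omega)
  case best =>
    refine ok_append (fun j => ok_w1_n1or ?_ (hpos _)) (fun _ => ok_wA (by simp only [al_aCert]; omega)) i
    simp only [List.mem_cons, List.not_mem_nil, or_false, forall_eq_or_imp, forall_eq, al_aCert, al_aLexLE]
    omega
  case ivbit =>
    split_ifs
    · refine ok_w1_n1and ?_ (hpos _)
      simp only [List.mem_cons, List.not_mem_nil, or_false, forall_eq_or_imp, forall_eq, al_aBest]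
      exact ⟨by omega, al_lbitA_lt L _ _ 5 (by norm_num)⟩
    · exact ok_wA (al_ffA_lt L _)
  case inonbot => exact ok_wA (by simp only [al_aCert]; omega)
  case isP =>
    split_ifs
    · exact ok_wA (by simp [Fin.val_last]; omega)
    · exact ok_wN (by simp [Fin.val_last]; omega)
    · exact ok_wA (al_ffA_lt L _)
  case pcov =>
    refine ok_w1_n1and ?_ (hpos _)
    simp only [List.mem_cons, List.not_mem_nil, or_false, forall_eq_or_imp, forall_eq, al_aIsP, al_aCert]
    omega
  case pnonbot =>
    split_ifs
    · exact ok_wA (by simp only [al_aPcov]; omega)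
    · exact ok_wA (al_ttA_lt L _)
  case pbit =>
    split_ifs with hb
    · split
      · refine ok_w1_n1and ?_ (hpos _)
        simp only [List.mem_cons, List.not_mem_nil, or_false, forall_eq_or_imp, forall_eq, al_aIsP]
        refine ⟨by omega, ?_⟩
        split_ifs <;> simp [SH]
      · split
        · exact ok_wA (al_ffA_lt L _)
        · rename_i Lc hc
          have hM := M_partLab_lt L hc
          refine ok_w1_n1and ?_ (hpos _)
          simp only [List.mem_cons, List.not_mem_nil, or_false, forall_eq_or_imp, forall_eq, al_aIsP]
          exact ⟨by omega, by simpa using child_main_lt hM 11 (by norm_num) _⟩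
    · exact ok_wA (al_ffA_lt L _)
  case rkInGE =>
    refine ok_cnt (fun w' => ?_) (hpos _) i
    split_ifs
    · exact ok_wA (by simp [Fin.val_last]; omega)
    · exact ok_wA (al_ffA_lt L _)
  case pcP =>
    rcases hc : partLab L P.us with _ | Lc
    · exact ok_wA (al_ffA_lt L _)
    · have hM := M_partLab_lt L hc
      dsimp only
      split_ifs
      · refine ok_w2_n2and ?_ (hpos _)
        simp only [List.mem_cons, List.not_mem_nil, or_false, forall_eq_or_imp, forall_eq]
        refine ⟨n1ok_litN1 (by simpa using child_main_lt hM 11 (by norm_num) _) (hpos _), n1ok_n1and ?_ (hpos _),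
          n1ok_EQF L _ _ (by omega)⟩
        simp only [List.mem_cons, List.not_mem_nil, or_false, forall_eq_or_imp, forall_eq, al_aRkInGE]
        omega
      · exact ok_wA (al_ffA_lt L _)
  case ppc =>
    refine ok_w1_n1and ?_ (hpos _)
    simp only [List.mem_cons, List.not_mem_nil, or_false, forall_eq_or_imp, forall_eq, al_aIsP, al_aPcP]
    omega
  case pcrk =>
    refine ok_w2_n2and ?_ (hpos _)
    simp only [List.mem_cons, List.not_mem_nil, or_false, forall_eq_or_imp, forall_eq]
    exact ⟨n1ok_litN1 (by simp only [al_aPpc]; omega) (hpos _), n1ok_rkF L _ _ (by omega)⟩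
  case ppfx =>
    split_ifs
    · exact ok_w2_iffF (al_pvecA_lt L _ _ 4 le_rfl) (al_pvecA_lt L _ _ 4 le_rfl) (hpos _)
    · exact ok_wA (al_ttA_lt L _)
  case plexLT =>
    refine ok_w1_n1and ?_ (hpos _)
    simp only [List.mem_cons, List.not_mem_nil, or_false, forall_eq_or_imp, forall_eq, al_aPpfx]
    exact ⟨by omega, al_pvecA_lt L _ _ 5 (by norm_num), al_pvecA_lt L _ _ 5 (by norm_num)⟩
  case pstGE =>
    refine ok_cnt (fun w => ok_w1_n1and ?_ (hpos _)) (hpos _) i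
    simp only [List.mem_cons, List.not_mem_nil, or_false, forall_eq_or_imp, forall_eq, al_aW, al_aPlexLT, Fin.val_last]
    omega
  case pbcGE =>
    refine ok_cnt (fun w => ok_w1_n1and ?_ (hpos _)) (hpos _) i
    simp only [List.mem_cons, List.not_mem_nil, or_false, forall_eq_or_imp, forall_eq, al_aW, al_aPlexEQ, Fin.val_last]
    omega
  case pat =>
    split_ifs
    · refine ok_w2_n2and ?_ (hpos _)
      simp only [List.mem_cons, List.not_mem_nil, or_false, forall_eq_or_imp, forall_eq]
      refine ⟨n1ok_n1and ?_ (hpos _), n1ok_litN1 ?_ (hpos _), n1ok_litN1 ?_ (hpos _)⟩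
      · simp only [List.mem_cons, List.not_mem_nil, or_false, forall_eq_or_imp, forall_eq, al_aPstGE]; omega
      · simp only [al_aPbit]; omega
      · simp only [al_aPbcGE]; omega
    · exact ok_wA (al_ffA_lt L _)
  case off => exact ok_wA (by simp only [al_aPat]; omega)
  case blkI => exact ok_wA (by simp only [al_aPat]; omega)
  case samePart =>
    refine ok_w1_n1and ?_ (hpos _)
    simp only [List.mem_cons, List.not_mem_nil, or_false, forall_eq_or_imp, forall_eq, al_aBlkI]
    omega
  case spc =>
    refine ok_w1_n1and ?_ (hpos _)
    simp only [List.mem_cons, List.not_mem_nil, or_false, forall_eq_or_imp, forall_eq, al_aOff, al_aPpc]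
    omega
  case svadj =>
    refine ok_append (fun j => ok_w1_n1and ?_ (hpos _)) (fun j => ok_w1_n1and ?_ (hpos _)) i
    · simp only [List.mem_cons, List.not_mem_nil, or_false, forall_eq_or_imp, forall_eq, al_aSamePart, al_aOff,
        al_aPbit]
      omega
    · simp only [List.mem_cons, List.not_mem_nil, or_false, forall_eq_or_imp, forall_eq, al_aSamePart, al_aSpc,
        al_aSw, Fin.val_last]
      omega
  case svext =>
    rcases ho : P.o1 with _ | o
    · exact ok_wA (al_ffA_lt L _)
    · refine ok_w1_n1and ?_ (hpos _)
      simp only [List.mem_cons, List.not_mem_nil, or_false, forall_eq_or_imp, forall_eq, al_aOff, al_aPbit]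
      omega
  case svcrk =>
    refine ok_w2_n2and ?_ (hpos _)
    simp only [List.mem_cons, List.not_mem_nil, or_false, forall_eq_or_imp, forall_eq]
    exact ⟨n1ok_litN1 (by simp only [al_aSpc]; omega) (hpos _), n1ok_rkF L _ _ (by omega)⟩
  case vbit =>
    split_ifs
    · exact ok_leafBitW L _ (by omega)
    · refine ok_w2_n2or ?_ (hpos _)
      simp only [List.mem_cons, List.not_mem_nil, or_false, forall_eq_or_imp, forall_eq]
      refine ⟨n1ok_n1and ?_ (hpos _), n1ok_n1and ?_ (hpos _)⟩
      · simp only [List.mem_cons, List.not_mem_nil, or_false, forall_eq_or_imp, forall_eq, al_aConn, al_aIvbit,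
          Fin.val_last]
        omega
      · simp only [List.mem_cons, List.not_mem_nil, or_false, forall_eq_or_imp, forall_eq, al_aConn, Fin.val_last]
        refine ⟨by omega, ?_⟩
        split <;> simp only [al_aSvadj, al_aSvext, al_aSvcrk] <;> omega
    · exact ok_wA (al_ffA_lt L _)
    · exact ok_wA (al_ffA_lt L _)

end Main

/-! ### All gates -/

omit [NeZero n] in
/-- Every label measure is below `MM`. -/
theorem M_lt_MM (L : Lab K n) : L.1.M < MM n := Nat.lt_succ_of_le (RawLab.M_le L.1)

/-- **Every wire of an atom points down.** -/
theorem Atom.args_ok (a : Atom K r n) (i : Fin a.fn.1) : OK a.al (a.args i) := by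
  cases a with
  | tt => exact i.elim0
  | ff => exact i.elim0
  | oo o o' => simp only [Atom.args]; split_ifs <;> exact ok_inl _
  | outv b =>
    refine ok_wA ?_
    have h3 : (Lab.root K n).1.M * BLK n + BLK n ≤ MM n * BLK n := by
      have := Nat.mul_le_mul_right (BLK n) (M_lt_MM (K := K) (Lab.root K n))
      rwa [Nat.succ_mul] at this
    have h4 : (T n + 1) * RS n + 11 < BLK n := by simp [BLK, MS]
    simp only [al_aVbit, lb]
    show _ < SH n + MM n * BLK n
    omega
  | sh k P => exact SKind.args_ok k P i
  | lab L k P =>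
    unfold Atom.args
    dsimp only
    split_ifs with hk
    · exact Kind.argsR_ok L k hk P i
    · exact Kind.argsM_ok L k (by simpa using hk) P i

/-- **Acyclicity**: every wire of every gate leads to a gate of strictly smaller level. -/
theorem Node.level_lt_of_args {l m : Node K r n} {i : Fin l.fn.1} (h : l.args i = Sum.inr m) : m.level < l.level := by
  cases l with
  | atom a =>
    have h1 := Atom.args_ok a i m h
    have h2 := m.level_le
    show m.level < 4 * a.al
    omega
  | natom a =>
    simp only [Node.args] at h
    cases h
    simp [Node.level]
  | f1 f =>
    simp only [Node.args, Lit.wire] at h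
    have hle : (f.ls i).1.al ≤ univ.sup fun j => (f.ls j).1.al := Finset.le_sup (f := fun j => (f.ls j).1.al) (mem_univ i)
    split_ifs at h <;> cases h <;> simp only [Node.level] <;> omega
  | f2 f =>
    simp only [Node.args] at h
    cases h
    have hle : (univ.sup fun j => ((f.xs i).ls j).1.al) ≤ univ.sup fun i' => univ.sup fun j => ((f.xs i').ls j).1.al :=
      Finset.le_sup (f := fun i' => univ.sup fun j => ((f.xs i').ls j).1.al) (mem_univ i)
    simp only [Node.level]; omega

end WCan

end Summit.PneNP.PneNP.Theorems

end
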